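import Summits.QuantumFields.BalabanUV.Beta.SymAveragingMixedJetWords
import Summits.QuantumFields.BalabanUV.Beta.RootedT2JetDictionary

/-!
# `BalabanUV.Beta.SymRootedJetDictionary` — THE ROOTED JET ↔ COUNT DICTIONARY (orders 0, 1, 2) FOR THE (0.4)-SYMMETRISED AVERAGING `symPhiGAt ρ`
# (β sub-cell, row D1; W-supplier an1 gen 43, TABLES-SYM-LEAN step S2c, module «33aσ»; scratch for a courier — FREEZE (0): an1 files nothing)

HONEST FRAMING (cell charter, verbatim): «discharging BetaPertH makes Bałaban's UV stability UNCONDITIONAL — a real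
constructive-QFT result; it is NOT the continuum limit and NOT the Clay problem.»  HONEST DEPENDENCY (verbatim): «continuum YM on
T⁴ ⇐ BetaPertH ∧ nine spine estimates (0/9 proved); BetaPertH ⇐ (D1) ∧ (D4) ∧ CAP+tail; G-an2-4 gates asym, D1 and NE2/3/4.»
DERIVED cell leaf: [folklore] the SYMMETRISED twins of an3's `RootedJetDictionary` (33a: `PhiGAt_X1`, `c11_logT_PhiGAt_Y`, `c00_PhiGAt`,
`PhiGAt_add_top`, `c11_logT_PhiGAt_Zf`), of leaf-05's `TruncatedNil4Calculus.aug_PhiGAt_eq_one` and of the four one-parameter corollaries of an3's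
`RootedT2JetDictionary` (`c10_/c01_PhiGAt_Y`, `PhiGAt_Y_zero`, `c11_logT_PhiGAt_Y_norm`), re-run VERBATIM with S2b's symmetrised averaging word
`symPhiGAt 𝕜 ρ G Ḡ L μ y = expT(((d!)²L^d)⁻¹ Σ_{x∈B(y)} Σ_{σ,σ′} logT hol(loop^{σ,σ′,ρ}_x)) · hol(c)` (S2b part 1 `SymAveragingMixedJetWords`) and S2a's
symmetrised letter functionals `symLinU ρ` ∕ `symHessUAt ρ` ∕ `symVhUAt ρ` (`SymAveragingHessianCountsWords` §3, weight `(d!)²` UNNORMALISED), using node 12's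
LIST-GENERIC letter calculus (`holG_X1`, `holY_c`, `hol_cross`, `logT_of_c00`, `expT_of_c00`) and an3's top-slot lemmas (`holG_add_top`, `logT_add_top`,
`expT_add_top`, `c00_holG`, `Zf_eq_Yf_add`, `Zb_eq_Yb_sub`) BY NAME.  THE DICTIONARY comb ↦ sym: `PhiGAt ↦ symPhiGAt`, `L^{-d} ↦ ((d!)²L^d)⁻¹`,
`loopCAt ρ ↦ loopPAt σ σ′ ρ` (summed over the pair family), `linAvgAt ρ A ↦ d! • symLinU ρ A`, `hessUAt ↦ symHessUAt`, `vhUAt ↦ symVhUAt`; every comb identity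
`X = (2L^d)⁻¹ • F` becomes `symX = (2(d!)²L^d)⁻¹ • symF`, at the price of the extra invertibility hypothesis `(d ! : 𝕜) ≠ 0` (the (0.4) mean divides by `(d!)²`).
No statement of Bałaban's papers is typed, no `[cite:]`, no `Prop` is minted, no binder of the β-function wall is instantiated or discharged.  NOT summit progress.

## What this module proves (any root `ρ`; `(d ! : 𝕜) ≠ 0`, `(L : 𝕜) ≠ 0`, `(2 : 𝕜) ≠ 0` where stated)

* §1 SYMMETRISED CONTOUR BOOKKEEPING `Σ_{x∈B(y)} Σ_{σ,σ′} A(loop^{σσ′ρ}_x) + (d!)²L^d • A(c^ρ) = d! • symLinU ρ A` (`sum_box_sum_loopPAt_add`) and the ORDER-0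
  SHADOW `symΦ^ρ(1 + σV) = 1 + σ · (d!·L^d)⁻¹ symLinU ρ V` (`symPhiGAt_X1`, `snd_symPhiGAt_X1`, `fst_symPhiGAt_X1`).
* §2 **THE UN-NORMALISED ONE-PARAMETER COMPUTATION** on node 12's shadow chart `Y_f = (1 + ρ W_f)(1 + σ B_f)`:
  `c11 (logT symΦ^ρ(Y)) = (2(d!)²L^d)⁻¹ • (symHessUAt ρ W B + d! • symLinU ρ [W,B])` (`c11_logT_symPhiGAt_Y`).
* §3 group-likeness and top-slot additivity of `symΦ^ρ` (`c00_symPhiGAt`, `aug_symPhiGAt_eq_one`, `symPhiGAt_add_top`), hence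
  **`c11 (logT symΦ^ρ(Zf W V, Zb W V)) = (2(d!)²L^d)⁻¹ • symHessUAt ρ W V`** (`c11_logT_symPhiGAt_Zf`).
* §4 the one-parameter corollaries consumed downstream by name: `c10_symPhiGAt_Y`, `c01_symPhiGAt_Y`, `symPhiGAt_Y_zero`, and the NORMALISED computation
  `c11 logT (symΦ^ρ(Y(W;B)) · symΦ^ρ(Y(0;B))⁻¹) = (2(d!)²L^{2d})⁻¹ • symVhUAt ρ W B` (`c11_logT_symPhiGAt_Y_norm`).

## What is NOT here
Nothing about the mixed chart beyond S2b part 1 (`symMjetAt`), no reflection (`sref`/`reflPair`) lemma, no table, no packed identity, no kernel.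
-/

namespace Summit.QuantumFields.BalabanUV.Beta.SymRootedJetDictionary

open Finset
open scoped BigOperators Nat
open Literature.MathematicalPhysics.QuantumFieldTheory.Balaban1983to89
open Literature.MathematicalPhysics.QuantumFieldTheory.Balaban1983to89.Beta
open Literature.MathematicalPhysics.QuantumFieldTheory.Balaban1983to89.Beta.AffineAveraging
open Literature.MathematicalPhysics.QuantumFieldTheory.Balaban1983to89.Beta.AveragingContours
open Literature.MathematicalPhysics.QuantumFieldTheory.Balaban1983to89.Beta.AveragingContoursRooted
open Literature.MathematicalPhysics.QuantumFieldTheory.Balaban1983to89.Beta.TransportedContourVariables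
open Literature.MathematicalPhysics.QuantumFieldTheory.Balaban1983to89.Beta.AveragingHessianKernels
open Literature.MathematicalPhysics.QuantumFieldTheory.Balaban1983to89.Beta.AveragingHessianKernelsRooted
open Literature.MathematicalPhysics.QuantumFieldTheory.Balaban1983to89.Beta.AveragingThirdJet
open Literature.MathematicalPhysics.QuantumFieldTheory.Balaban1983to89.Beta.AveragingThirdJet.Tau
open Literature.MathematicalPhysics.QuantumFieldTheory.Balaban1983to89.Beta.AveragingMixedJetTables
open Summit.QuantumFields.BalabanUV.Beta.SymmetrisedAxialPotential (card_perm_fin)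
open Summit.QuantumFields.BalabanUV.Beta.SymAveragingHessianCounts (axialP gammaPAt loopPAt loopPAt_map symLinU symHessUAt symVhUAt
  symLinU_mapForm symHessUAt_symm)
open Summit.QuantumFields.BalabanUV.Beta.SymAveragingMixedJetTables (lettersIn_loopPAt_top symPhiGAt map_symPhiGAt symPhiGAt_one)
open Summit.QuantumFields.BalabanUV.Beta.RootedJetDictionary (mul_mk_top mk_top_mul mk_top_add c00_holG c00_logT logT_add_top expT_add_top
  holG_add_top half_add_half Zf_eq_Yf_add Zb_eq_Yb_sub)
open Summit.QuantumFields.BalabanUV.Beta.RootedJetTwist (lineHom)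
open Summit.QuantumFields.BalabanUV.Beta.RootedT2JetDictionary (pr1 pr2 snd_pr1 snd_pr2 c11_eq_logT_add)

variable {𝕜 : Type*} [Field 𝕜] {d : ℕ} {𝔸 : Type*} [Ring 𝔸] [Algebra 𝕜 𝔸]

/-! ## §1 Symmetrised contour bookkeeping and the order-`0` shadow -/

omit [Algebra 𝕜 𝔸] in
/-- [folklore] **SYMMETRISED ROOTED CONTOUR BOOKKEEPING** over an arbitrary additive group:
`Σ_{x ∈ B(y)} Σ_{σ,σ′} A(loop^{σσ′ρ}_x) + (d!)²L^d • A(c^ρ) = d! • symLinU ρ A` (the pair words share the middle bond and the root bond; summing the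
independent lower∕upper orders contributes one factor `d!` each). -/
theorem sum_box_sum_loopPAt_add {R : Type*} [AddCommGroup R] (ρ : Fin d → ℤ) (A : Form1 d R) (L : ℕ) (μ : Fin d) (y : Fin d → ℤ) :
    ∑ b ∈ box d L, ∑ σ : Equiv.Perm (Fin d), ∑ σ' : Equiv.Perm (Fin d), (loopPAt σ σ' ρ A L μ y b).sum
        + ((d !) ^ 2 * L ^ d) • (segUp A ((L : ℤ) • y + ρ) μ L).sum
      = (d !) • (∑ σ : Equiv.Perm (Fin d), ∑ b ∈ box d L, (gammaPAt σ σ ρ A L μ y b).sum) := by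
  have hcard : (box d L).card = L ^ d := by simp [AffineAveraging.box, Fintype.card_piFinset]
  set c := (segUp A ((L : ℤ) • y + ρ) μ L).sum with hc
  set low : Equiv.Perm (Fin d) → (Fin d → ℕ) → R := fun σ b => (axialP σ A ((L : ℤ) • y + ρ) ((L : ℤ) • y + toSite b)).sum
    with hlow
  set mid : (Fin d → ℕ) → R := fun b => (segUp A ((L : ℤ) • y + toSite b) μ L).sum with hmid
  set up : Equiv.Perm (Fin d) → (Fin d → ℕ) → R := fun σ b =>
    (axialP σ A ((L : ℤ) • y + ρ + (L : ℤ) • unitVec μ) ((L : ℤ) • y + toSite b + (L : ℤ) • unitVec μ)).sum with hup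
  have hloop : ∀ b σ σ', (loopPAt σ σ' ρ A L μ y b).sum = low σ b + mid b - up σ' b - c := by
    intro b σ σ'
    simp only [loopPAt, gammaPAt, List.sum_append, rev_sum, hlow, hmid, hup, hc]
    abel
  have hgam : ∀ b σ, (gammaPAt σ σ ρ A L μ y b).sum = low σ b + mid b - up σ b := by
    intro b σ
    simp only [gammaPAt, List.sum_append, rev_sum, hlow, hmid, hup]
    abel
  have key : ∀ b, ∑ σ : Equiv.Perm (Fin d), ∑ σ' : Equiv.Perm (Fin d), (loopPAt σ σ' ρ A L μ y b).sum
      = (d !) • (∑ σ : Equiv.Perm (Fin d), (gammaPAt σ σ ρ A L μ y b).sum) - ((d !) * (d !)) • c := by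
    intro b
    simp only [hloop, hgam, Finset.sum_sub_distrib, Finset.sum_add_distrib, Finset.sum_const, Finset.card_univ, card_perm_fin,
      smul_add, smul_sub, Finset.smul_sum, smul_smul]
  rw [Finset.sum_congr rfl fun b _ => key b, Finset.sum_sub_distrib, Finset.sum_const, hcard, ← Finset.smul_sum, smul_smul, sq,
    sub_add_eq_add_sub, sub_eq_iff_eq_add, mul_comm (L ^ d), Finset.sum_comm]

/-- [folklore] … packaged with S2a's `symLinU` (rings). -/
theorem sum_box_sum_loopPAt_add' (ρ : Fin d → ℤ) (A : Form1 d 𝔸) (L : ℕ) (μ : Fin d) (y : Fin d → ℤ) :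
    ∑ b ∈ box d L, ∑ σ : Equiv.Perm (Fin d), ∑ σ' : Equiv.Perm (Fin d), (loopPAt σ σ' ρ A L μ y b).sum
        + ((d !) ^ 2 * L ^ d) • (segUp A ((L : ℤ) • y + ρ) μ L).sum
      = (d !) • symLinU ρ A L μ y :=
  sum_box_sum_loopPAt_add ρ A L μ y

/-- [folklore] The (0.4) weight is invertible when `d!` and `L` are. -/
theorem symWeight_ne_zero (hd : ((d ! : ℕ) : 𝕜) ≠ 0) {L : ℕ} (hL : (L : 𝕜) ≠ 0) : ((d ! : 𝕜) ^ 2 * (L : 𝕜) ^ d) ≠ 0 :=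
  mul_ne_zero (pow_ne_zero 2 hd) (pow_ne_zero d hL)

/-- [folklore] … solved for the loop sum, over `𝕜`: `((d!)²L^d)⁻¹ Σ_x Σ_{σσ′} A(loop) = (d!·L^d)⁻¹ symLinU ρ A − A(c^ρ)`. -/
theorem inv_smul_sum_box_loopPAt (ρ : Fin d → ℤ) (A : Form1 d 𝔸) (hd : ((d ! : ℕ) : 𝕜) ≠ 0) {L : ℕ} (hL : (L : 𝕜) ≠ 0) (μ : Fin d)
    (y : Fin d → ℤ) :
    ((d ! : 𝕜) ^ 2 * (L : 𝕜) ^ d)⁻¹ • ∑ b ∈ box d L, ∑ σ : Equiv.Perm (Fin d), ∑ σ' : Equiv.Perm (Fin d), (loopPAt σ σ' ρ A L μ y b).sum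
      = ((d ! : 𝕜) * (L : 𝕜) ^ d)⁻¹ • symLinU ρ A L μ y - (segUp A ((L : ℤ) • y + ρ) μ L).sum := by
  have hw : ((d ! : 𝕜) ^ 2 * (L : 𝕜) ^ d)⁻¹ * (d ! : 𝕜) = ((d ! : 𝕜) * (L : 𝕜) ^ d)⁻¹ := by
    rw [sq, mul_assoc, mul_inv, mul_assoc, mul_comm (((d ! : 𝕜) * (L : 𝕜) ^ d)⁻¹), ← mul_assoc, inv_mul_cancel₀ hd, one_mul]
  rw [eq_sub_of_add_eq (sum_box_sum_loopPAt_add' ρ A L μ y), smul_sub]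
  simp only [← Nat.cast_smul_eq_nsmul 𝕜, smul_smul, Nat.cast_mul, Nat.cast_pow, inv_mul_cancel₀ (symWeight_ne_zero hd hL), one_smul,
    hw]

/-- [folklore] (42)ρσ ON THE ORDER-`0` SHADOW: `symΦ^ρ(1 + σV) = 1 + σ (V(c^ρ) + ((d!)²L^d)⁻¹ Σ_x Σ_{σσ′} V(loop))`. -/
theorem symPhiGAt_X1 (ρ : Fin d → ℤ) (V : Form1 d 𝔸) (L : ℕ) (μ : Fin d) (y : Fin d → ℤ) :
    symPhiGAt 𝕜 ρ (X1 V) (X1b V) L μ y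
      = dmk 1 ((segUp V ((L : ℤ) • y + ρ) μ L).sum
          + ((d ! : 𝕜) ^ 2 * (L : 𝕜) ^ d)⁻¹ • ∑ b ∈ box d L, ∑ σ : Equiv.Perm (Fin d), ∑ σ' : Equiv.Perm (Fin d),
              (loopPAt σ σ' ρ V L μ y b).sum) := by
  rw [symPhiGAt]
  have hlog : ∀ b σ σ', logT 𝕜 (holG (X1 V) (X1b V) (loopPAt σ σ' ρ δ L μ y b)) = dmk 0 ((loopPAt σ σ' ρ V L μ y b).sum) := by
    intro b σ σ'
    rw [holG_X1 V (lettersIn_loopPAt_top σ σ' ρ δ L μ y b), loopPAt_map, mapForm_letterHom]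
    exact logT_dmk_one _
  simp only [hlog, sum_dmk_zero]
  rw [holG_X1 V (lettersIn_segUp_top δ _ μ L), segUp_map, mapForm_letterHom, smul_dmk_zero, expT_dmk_zero]
  exact TrivSqZeroExt.ext (by simp) (by simp)

/-- [folklore] **ORDER-0 IDENTIFICATION (symmetrised)**: the `σ`-part of `symΦ^ρ(1 + σV)` is `(d!·L^d)⁻¹ • symLinU ρ V`. -/
theorem snd_symPhiGAt_X1 (ρ : Fin d → ℤ) (V : Form1 d 𝔸) (hd : ((d ! : ℕ) : 𝕜) ≠ 0) {L : ℕ} (hL : (L : 𝕜) ≠ 0) (μ : Fin d)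
    (y : Fin d → ℤ) : (symPhiGAt 𝕜 ρ (X1 V) (X1b V) L μ y).snd = ((d ! : 𝕜) * (L : 𝕜) ^ d)⁻¹ • symLinU ρ V L μ y := by
  rw [symPhiGAt_X1, snd_dmk, inv_smul_sum_box_loopPAt ρ V hd hL, add_sub_cancel]

/-- [folklore] … and its group part is `1`. -/
theorem fst_symPhiGAt_X1 (ρ : Fin d → ℤ) (V : Form1 d 𝔸) (L : ℕ) (μ : Fin d) (y : Fin d → ℤ) :
    (symPhiGAt 𝕜 ρ (X1 V) (X1b V) L μ y).fst = 1 := by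
  rw [symPhiGAt_X1, fst_dmk]

/-! ## §2 The un-normalised one-parameter computation on the shadow chart `Y_f = (1 + ρ W_f)(1 + σ B_f)` -/

/-- [folklore] **THE UN-NORMALISED ONE-PARAMETER COMPUTATION (symmetrised)**: the `σρ`-component of `logT symΦ^ρ(Y(W;B))` is
`(2(d!)²L^d)⁻¹ • (symHessUAt ρ W B + d! • symLinU ρ [W,B])`. -/
theorem c11_logT_symPhiGAt_Y (ρ : Fin d → ℤ) (W B : Form1 d 𝔸) (hd : ((d ! : ℕ) : 𝕜) ≠ 0) {L : ℕ} (hL : (L : 𝕜) ≠ 0)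
    (h2 : (2 : 𝕜) ≠ 0) (μ : Fin d) (y : Fin d → ℤ) :
    c11 (logT 𝕜 (symPhiGAt 𝕜 ρ (Yf W B) (Yb W B) L μ y))
      = ((2 : 𝕜) * ((d ! : 𝕜) ^ 2 * (L : 𝕜) ^ d))⁻¹ • (symHessUAt ρ W B L μ y + (d ! : ℤ) • symLinU ρ (bw W B) L μ y) := by
  have hℓ : ((L : 𝕜) ^ d) ≠ 0 := pow_ne_zero d hL
  -- loop data
  have hb : ∀ b σ σ', logT 𝕜 (holG (Yf W B) (Yb W B) (loopPAt σ σ' ρ δ L μ y b))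
      = mk 0 ((loopPAt σ σ' ρ B L μ y b).sum) ((loopPAt σ σ' ρ W L μ y b).sum)
          ((2 : 𝕜)⁻¹ • ((loopPAt σ σ' ρ (bw W B) L μ y b).sum + cross (loopPAt σ σ' ρ (pairForm W B) L μ y b))) := by
    intro b σ σ'
    have hl := lettersIn_loopPAt_top σ σ' ρ δ L μ y b
    obtain ⟨h0, h1, h1'⟩ := holY_c W B hl
    have hx := hol_cross W B hl
    rw [loopPAt_map, mapForm_letterHom] at h1 h1'
    simp only [loopPAt_map, mapForm_letterHom, mapForm_letterHom₂] at hx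
    rw [logT_of_c00 _ h0, h1, h1', half_of_two h2 hx]
  -- c-path data (from the root)
  obtain ⟨k0, k1, k1'⟩ := holY_c W B (lettersIn_segUp_top δ ((L : ℤ) • y + ρ) μ L)
  have kx := hol_cross W B (lettersIn_segUp_top δ ((L : ℤ) • y + ρ) μ L)
  rw [segUp_map, mapForm_letterHom] at k1 k1'
  simp only [segUp_map, mapForm_letterHom, mapForm_letterHom₂] at kx
  have kc : holG (Yf W B) (Yb W B) (segUp δ ((L : ℤ) • y + ρ) μ L)
      = mk 1 ((segUp B ((L : ℤ) • y + ρ) μ L).sum) ((segUp W ((L : ℤ) • y + ρ) μ L).sum)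
          ((2 : 𝕜)⁻¹ • (((segUp (bw W B) ((L : ℤ) • y + ρ) μ L).sum
              + cross (segUp (pairForm W B) ((L : ℤ) • y + ρ) μ L))
            + ((segUp B ((L : ℤ) • y + ρ) μ L).sum * (segUp W ((L : ℤ) • y + ρ) μ L).sum
              + (segUp W ((L : ℤ) • y + ρ) μ L).sum * (segUp B ((L : ℤ) • y + ρ) μ L).sum))) := by
    rw [← mk_eq (holG (Yf W B) (Yb W B) (segUp δ ((L : ℤ) • y + ρ) μ L)), k0, k1, k1', eq_half h2 kx]
  -- assemble (42)ρσ
  rw [symPhiGAt]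
  simp only [hb, sum_mk_zero]
  rw [kc, smul_mk, expT_of_c00 _ (by simp)]
  simp only [c10_mk, c01_mk, c11_mk, smul_zero]
  rw [logT_of_c00 _ (by simp)]
  simp only [c11_mk, c10_mk, c01_mk, c00_mk, c11_mul, c10_mul, c01_mul]
  simp only [mul_one, one_mul]
  -- contour bookkeeping and S2a's definitions
  simp only [← Finset.smul_sum, Finset.sum_add_distrib]
  rw [eq_sub_of_add_eq (sum_box_sum_loopPAt_add' ρ W L μ y), eq_sub_of_add_eq (sum_box_sum_loopPAt_add' ρ B L μ y),
    eq_sub_of_add_eq (sum_box_sum_loopPAt_add' ρ (bw W B) L μ y)]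
  simp only [symHessUAt, AveragingHessianKernels.comm, ← Nat.cast_smul_eq_nsmul 𝕜, ← Int.cast_smul_eq_zsmul 𝕜, Nat.cast_pow,
    Nat.cast_mul, Int.cast_pow, Int.cast_mul, Int.cast_natCast]
  -- the letter functionals are now opaque atoms of a `𝕜`-module identity
  generalize (∑ b ∈ box d L, ∑ σ : Equiv.Perm (Fin d), ∑ σ' : Equiv.Perm (Fin d), cross (loopPAt σ σ' ρ (pairForm W B) L μ y b)) = Xb
  generalize cross (segUp (pairForm W B) ((L : ℤ) • y + ρ) μ L) = Xc
  generalize symLinU ρ (bw W B) L μ y = Lbw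
  generalize (segUp (bw W B) ((L : ℤ) • y + ρ) μ L).sum = cbw
  generalize symLinU ρ B L μ y = lB
  generalize symLinU ρ W L μ y = lW
  generalize (segUp B ((L : ℤ) • y + ρ) μ L).sum = cB
  generalize (segUp W ((L : ℤ) • y + ρ) μ L).sum = cW
  generalize ((L : 𝕜) ^ d) = ℓ at hℓ ⊢
  generalize ((d ! : ℕ) : 𝕜) = D at hd ⊢
  simp only [smul_sub, smul_add, mul_add, add_mul, mul_sub, sub_mul, smul_mul_assoc, mul_smul_comm, smul_smul]
  match_scalars <;> (field_simp; try ring)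

/-! ## §3 Group-likeness, top-slot additivity, and the symmetric letter `Zf W V` -/

/-- [folklore] The symmetrised averaged exponent `((d!)²L^d)⁻¹ Σ_x Σ_{σσ′} logT hol(loop)` of group-like letters lies in the augmentation ideal. -/
theorem c00_symAvg_logT_holG {G Gb : Form1 d (Tau 𝔸)} (hG : ∀ κ x, c00 (G κ x) = 1) (hGb : ∀ κ x, c00 (Gb κ x) = 1)
    (ρ : Fin d → ℤ) (L : ℕ) (μ : Fin d) (y : Fin d → ℤ) :
    c00 (((d ! : 𝕜) ^ 2 * (L : 𝕜) ^ d)⁻¹ • ∑ b ∈ box d L, ∑ σ : Equiv.Perm (Fin d), ∑ σ' : Equiv.Perm (Fin d),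
        logT 𝕜 (holG G Gb (loopPAt σ σ' ρ δ L μ y b))) = 0 := by
  rw [c00_smul, ← Tau.aug_apply (𝕜 := 𝕜), map_sum, Finset.sum_eq_zero, smul_zero]
  intro b _
  rw [map_sum]
  refine Finset.sum_eq_zero fun σ _ => ?_
  rw [map_sum]
  refine Finset.sum_eq_zero fun σ' _ => ?_
  rw [Tau.aug_apply, c00_logT (c00_holG hG hGb (lettersIn_loopPAt_top σ σ' ρ δ L μ y b))]

/-- [folklore] Group-like letters have a group-like symmetrised rooted averaging (`c00 symΦ^ρ = 1`). -/
theorem c00_symPhiGAt {G Gb : Form1 d (Tau 𝔸)} (hG : ∀ κ x, c00 (G κ x) = 1) (hGb : ∀ κ x, c00 (Gb κ x) = 1) (ρ : Fin d → ℤ)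
    (L : ℕ) (μ : Fin d) (y : Fin d → ℤ) : c00 (symPhiGAt 𝕜 ρ G Gb L μ y) = 1 := by
  rw [symPhiGAt, c00_mul, expT_of_c00 _ (c00_symAvg_logT_holG hG hGb ρ L μ y), c00_mk, one_mul,
    c00_holG hG hGb (lettersIn_segUp_top δ _ μ L)]

/-- [folklore] **`ag (symΦ^ρ_b(G, Ḡ)) = 1`**: the symmetrised rooted averaging of transporters `≡ 1 mod 𝔪` is `≡ 1 mod 𝔪` (naturality `map_symPhiGAt` +
`symPhiGAt_one`; sym twin of leaf-05's `TruncatedNil4Calculus.aug_PhiGAt_eq_one`). -/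
theorem aug_symPhiGAt_eq_one {R R₀ : Type*} [Ring R] [Algebra 𝕜 R] [Ring R₀] [Algebra 𝕜 R₀] {ag : R →ₐ[𝕜] R₀} {G Gb : Form1 d R}
    (hG : ∀ κ x, ag (G κ x) = 1) (hGb : ∀ κ x, ag (Gb κ x) = 1) (ρ : Fin d → ℤ) (L : ℕ) (μ : Fin d) (y : Fin d → ℤ) :
    ag (symPhiGAt 𝕜 ρ G Gb L μ y) = 1 := by
  rw [map_symPhiGAt]
  have e1 : (fun κ x => ag (G κ x)) = fun _ _ => (1 : R₀) := by funext κ x; exact hG κ x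
  have e2 : (fun κ x => ag (Gb κ x)) = fun _ _ => (1 : R₀) := by funext κ x; exact hGb κ x
  rw [e1, e2]
  exact symPhiGAt_one ρ L μ y

/-- [folklore] **TOP-SLOT PERTURBATIONS ARE ADDITIVE THROUGH THE SYMMETRISED ROOTED AVERAGING**:
`symΦ^ρ(G + τ₁τ₂ c, Ḡ − τ₁τ₂ c) = symΦ^ρ(G, Ḡ) + τ₁τ₂ (c(c^ρ) + ((d!)²L^d)⁻¹ Σ_x Σ_{σσ′} c(loop))`. -/
theorem symPhiGAt_add_top {G Gb : Form1 d (Tau 𝔸)} (hG : ∀ κ x, c00 (G κ x) = 1) (hGb : ∀ κ x, c00 (Gb κ x) = 1) (c : Form1 d 𝔸)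
    (ρ : Fin d → ℤ) (L : ℕ) (μ : Fin d) (y : Fin d → ℤ) :
    symPhiGAt 𝕜 ρ (fun κ x => G κ x + mk 0 0 0 (c κ x)) (fun κ x => Gb κ x - mk 0 0 0 (c κ x)) L μ y
      = symPhiGAt 𝕜 ρ G Gb L μ y
        + mk 0 0 0 ((segUp c ((L : ℤ) • y + ρ) μ L).sum
            + ((d ! : 𝕜) ^ 2 * (L : 𝕜) ^ d)⁻¹ • ∑ b ∈ box d L, ∑ σ : Equiv.Perm (Fin d), ∑ σ' : Equiv.Perm (Fin d),
                (loopPAt σ σ' ρ c L μ y b).sum) := by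
  have hlog : ∀ b σ σ',
      logT 𝕜 (holG (fun κ x => G κ x + mk 0 0 0 (c κ x)) (fun κ x => Gb κ x - mk 0 0 0 (c κ x)) (loopPAt σ σ' ρ δ L μ y b))
        = logT 𝕜 (holG G Gb (loopPAt σ σ' ρ δ L μ y b)) + mk 0 0 0 ((loopPAt σ σ' ρ c L μ y b).sum) := by
    intro b σ σ'
    rw [holG_add_top hG hGb c (lettersIn_loopPAt_top σ σ' ρ δ L μ y b), loopPAt_map, mapForm_letterHom,
      logT_add_top _ (c00_holG hG hGb (lettersIn_loopPAt_top σ σ' ρ δ L μ y b))]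
  have hA := c00_symAvg_logT_holG (𝕜 := 𝕜) hG hGb ρ L μ y
  have hE : c00 (expT 𝕜 (((d ! : 𝕜) ^ 2 * (L : 𝕜) ^ d)⁻¹ • ∑ b ∈ box d L, ∑ σ : Equiv.Perm (Fin d), ∑ σ' : Equiv.Perm (Fin d),
      logT 𝕜 (holG G Gb (loopPAt σ σ' ρ δ L μ y b)))) = 1 := by
    rw [expT_of_c00 _ hA, c00_mk]
  have hC := c00_holG hG hGb (lettersIn_segUp_top δ ((L : ℤ) • y + ρ) μ L)
  rw [symPhiGAt, symPhiGAt]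
  simp only [hlog, Finset.sum_add_distrib, sum_mk_zero, Finset.sum_const_zero, smul_add, smul_mk, smul_zero]
  rw [expT_add_top _ hA, holG_add_top hG hGb c (lettersIn_segUp_top δ _ μ L), segUp_map, mapForm_letterHom, add_mul, mul_add,
    mul_add, mul_mk_top, mk_top_mul, mk_top_mul, hE, hC, c00_mk, one_mul, mul_one, mul_zero, mk_top_add, add_zero, add_assoc,
    mk_top_add]

/-- [folklore] `symLinU ρ [V,W] = − symLinU ρ [W,V]`. -/
theorem symLinU_bw_swap (ρ : Fin d → ℤ) (W V : Form1 d 𝔸) (L : ℕ) (μ : Fin d) (y : Fin d → ℤ) :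
    symLinU ρ (bw V W) L μ y = -symLinU ρ (bw W V) L μ y := by
  have h : bw V W = mapForm (-(AddMonoidHom.id 𝔸)) (bw W V) := by
    funext κ x; simp [mapForm, AveragingHessianKernels.comm, neg_sub]
  rw [h, symLinU, symLinU_mapForm]; rfl

/-- [folklore] `symLinU ρ (c • A) = c • symLinU ρ A`. -/
theorem symLinU_smul (ρ : Fin d → ℤ) (c : 𝕜) (A : Form1 d 𝔸) (L : ℕ) (μ : Fin d) (y : Fin d → ℤ) :
    symLinU ρ (fun κ x => c • A κ x) L μ y = c • symLinU ρ A L μ y := by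
  have h : (fun κ x => c • A κ x) = mapForm (DistribSMul.toAddMonoidHom 𝔸 c) A := by
    funext κ x; simp [mapForm]
  rw [h, symLinU, symLinU_mapForm]; rfl

/-- [folklore] **THE SYMMETRIC CHART COMPUTES THE POLARISED SYMMETRISED HESSIAN FUNCTIONAL**:
`c11 (logT symΦ^ρ(Zf W V, Zb W V)) = (2(d!)²L^d)⁻¹ • symHessUAt ρ W V` — the local commutator letter sums of §2 and of the perturbation cancel exactly. -/
theorem c11_logT_symPhiGAt_Zf (ρ : Fin d → ℤ) (W V : Form1 d 𝔸) (hd : ((d ! : ℕ) : 𝕜) ≠ 0) {L : ℕ} (hL : (L : 𝕜) ≠ 0)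
    (h2 : (2 : 𝕜) ≠ 0) (μ : Fin d) (y : Fin d → ℤ) :
    c11 (logT 𝕜 (symPhiGAt 𝕜 ρ (Zf 𝕜 W V) (Zb 𝕜 W V) L μ y))
      = ((2 : 𝕜) * ((d ! : 𝕜) ^ 2 * (L : 𝕜) ^ d))⁻¹ • symHessUAt ρ W V L μ y := by
  have hℓ : ((L : 𝕜) ^ d) ≠ 0 := pow_ne_zero d hL
  have hY : ∀ κ x, c00 (Yf V W κ x) = 1 := fun κ x => by simp [Yf]
  have hYb : ∀ κ x, c00 (Yb V W κ x) = 1 := fun κ x => by simp [Yb]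
  have h1 : c00 (symPhiGAt 𝕜 ρ (Yf V W) (Yb V W) L μ y) = 1 := c00_symPhiGAt hY hYb ρ L μ y
  rw [Zf_eq_Yf_add h2, Zb_eq_Yb_sub h2, symPhiGAt_add_top hY hYb _ ρ L μ y, logT_add_top _ h1, c11_add, c11_mk,
    c11_logT_symPhiGAt_Y ρ V W hd hL h2, inv_smul_sum_box_loopPAt ρ _ hd hL, add_sub_cancel, symLinU_smul, symLinU_bw_swap,
    symHessUAt_symm]
  simp only [← Int.cast_smul_eq_zsmul 𝕜, Int.cast_natCast, smul_add, smul_neg, smul_smul]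
  generalize symHessUAt ρ W V L μ y = H
  generalize symLinU ρ (bw W V) L μ y = S
  generalize ((L : 𝕜) ^ d) = ℓ at hℓ ⊢
  generalize ((d ! : ℕ) : 𝕜) = D at hd ⊢
  match_scalars <;> (field_simp; try ring)

/-! ## §4 One-parameter corollaries consumed downstream by name (sym twins of `RootedT2JetDictionary` §3) -/

section OneParameter

variable (hd : ((d ! : ℕ) : 𝕜) ≠ 0) {L : ℕ} (hL : (L : 𝕜) ≠ 0) (h2 : (2 : 𝕜) ≠ 0)
include hd hL

/-- [folklore] `c10 symΦ^ρ(Y(W;B)) = (d!·L^d)⁻¹ • S_B` (projection `pr1`: `Y(W;B) ↦ 1 + εB`). -/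
theorem c10_symPhiGAt_Y (ρ : Fin d → ℤ) (W B : Form1 d 𝔸) (μ : Fin d) (y : Fin d → ℤ) :
    c10 (symPhiGAt 𝕜 ρ (Yf W B) (Yb W B) L μ y) = ((d ! : 𝕜) * (L : 𝕜) ^ d)⁻¹ • symLinU ρ B L μ y := by
  have hf : (fun κ x => pr1 (𝕜 := 𝕜) (Yf W B κ x)) = X1 B := by
    funext κ x; exact TrivSqZeroExt.ext (by simp [Yf, X1]) (by simp [Yf, X1])
  have hb : (fun κ x => pr1 (𝕜 := 𝕜) (Yb W B κ x)) = X1b B := by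
    funext κ x; exact TrivSqZeroExt.ext (by simp [Yb, X1b]) (by simp [Yb, X1b])
  have key := congrArg TrivSqZeroExt.snd (map_symPhiGAt (pr1 (𝕜 := 𝕜)) ρ (Yf W B) (Yb W B) L μ y)
  rw [hf, hb, snd_symPhiGAt_X1 ρ B hd hL, snd_pr1] at key
  exact key

/-- [folklore] `c01 symΦ^ρ(Y(W;B)) = (d!·L^d)⁻¹ • S_W` (projection `pr2`: `Y(W;B) ↦ 1 + εW`). -/
theorem c01_symPhiGAt_Y (ρ : Fin d → ℤ) (W B : Form1 d 𝔸) (μ : Fin d) (y : Fin d → ℤ) :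
    c01 (symPhiGAt 𝕜 ρ (Yf W B) (Yb W B) L μ y) = ((d ! : 𝕜) * (L : 𝕜) ^ d)⁻¹ • symLinU ρ W L μ y := by
  have hf : (fun κ x => pr2 (𝕜 := 𝕜) (Yf W B κ x)) = X1 W := by
    funext κ x; exact TrivSqZeroExt.ext (by simp [Yf, X1]) (by simp [Yf, X1])
  have hb : (fun κ x => pr2 (𝕜 := 𝕜) (Yb W B κ x)) = X1b W := by
    funext κ x; exact TrivSqZeroExt.ext (by simp [Yb, X1b]) (by simp [Yb, X1b])
  have key := congrArg TrivSqZeroExt.snd (map_symPhiGAt (pr2 (𝕜 := 𝕜)) ρ (Yf W B) (Yb W B) L μ y)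
  rw [hf, hb, snd_symPhiGAt_X1 ρ W hd hL, snd_pr2] at key
  exact key

/-- [folklore] THE FLUCTUATION-FREE REFERENCE: `symΦ^ρ(Y(0;B)) = mk 1 ((d!·L^d)⁻¹ • S_B) 0 0` (it lies on the `τ₁`-line, `lineHom`). -/
theorem symPhiGAt_Y_zero (ρ : Fin d → ℤ) (B : Form1 d 𝔸) (μ : Fin d) (y : Fin d → ℤ) :
    symPhiGAt 𝕜 ρ (Yf 0 B) (Yb 0 B) L μ y = mk 1 (((d ! : 𝕜) * (L : 𝕜) ^ d)⁻¹ • symLinU ρ B L μ y) 0 0 := by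
  have hf : (Yf (0 : Form1 d 𝔸) B) = fun κ x => lineHom (𝕜 := 𝕜) (X1 B κ x) := by
    funext κ x; exact ext4 (by simp [Yf, X1]) (by simp [Yf, X1]) (by simp [Yf, X1]) (by simp [Yf, X1])
  have hb : (Yb (0 : Form1 d 𝔸) B) = fun κ x => lineHom (𝕜 := 𝕜) (X1b B κ x) := by
    funext κ x; exact ext4 (by simp [Yb, X1b]) (by simp [Yb, X1b]) (by simp [Yb, X1b]) (by simp [Yb, X1b])
  rw [hf, hb, ← map_symPhiGAt (lineHom (𝕜 := 𝕜)) ρ (X1 B) (X1b B) L μ y, symPhiGAt_X1, inv_smul_sum_box_loopPAt ρ B hd hL,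
    add_sub_cancel]
  exact ext4 (by simp) (by simp) (by simp) (by simp)

include h2 in
/-- [folklore] **THE NORMALISED ONE-PARAMETER COMPUTATION (symmetrised)**:
`c11 logT (symΦ^ρ(Y(W;B)) · symΦ^ρ(Y(0;B))⁻¹) = (2(d!)²L^{2d})⁻¹ • symVhUAt ρ W B` — S2a's symmetrised field–multiplier functional. -/
theorem c11_logT_symPhiGAt_Y_norm (ρ : Fin d → ℤ) (W B : Form1 d 𝔸) (μ : Fin d) (y : Fin d → ℤ) :
    c11 (logT 𝕜 (symPhiGAt 𝕜 ρ (Yf W B) (Yb W B) L μ y * invT (symPhiGAt 𝕜 ρ (Yf 0 B) (Yb 0 B) L μ y)))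
      = ((2 : 𝕜) * ((d ! : 𝕜) ^ 2 * (L : 𝕜) ^ (2 * d)))⁻¹ • symVhUAt ρ W B L μ y := by
  have hℓ : ((L : 𝕜) ^ d) ≠ 0 := pow_ne_zero d hL
  have h00 : c00 (symPhiGAt 𝕜 ρ (Yf W B) (Yb W B) L μ y) = 1 :=
    c00_symPhiGAt (fun κ x => by simp [Yf]) (fun κ x => by simp [Yb]) ρ L μ y
  have h11 := c11_eq_logT_add (𝕜 := 𝕜) _ h00
  have hq : c00 (symPhiGAt 𝕜 ρ (Yf W B) (Yb W B) L μ y * mk 1 (-(((d ! : 𝕜) * (L : 𝕜) ^ d)⁻¹ • symLinU ρ B L μ y)) 0 0) = 1 := by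
    simp [h00]
  rw [symPhiGAt_Y_zero hd hL ρ B μ y, invT_mk_one, logT_of_c00 _ hq, c11_mk]
  simp only [c10_mul, c01_mul, c11_mul, c00_mk, c10_mk, c01_mk, c11_mk, h00, h11, c10_symPhiGAt_Y hd hL,
    c01_symPhiGAt_Y hd hL, c11_logT_symPhiGAt_Y ρ W B hd hL h2, mul_one, one_mul, mul_zero, zero_mul, add_zero, zero_add,
    neg_add_cancel, smul_zero, sub_zero]
  simp only [symVhUAt, AveragingHessianKernels.comm, ← Int.cast_smul_eq_zsmul 𝕜, Int.cast_pow, Int.cast_mul, Int.cast_natCast,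
    smul_add, smul_sub, mul_neg, smul_mul_assoc, mul_smul_comm, smul_smul, pow_mul', sq]
  generalize symHessUAt ρ W B L μ y = H
  generalize symLinU ρ (bw W B) L μ y = Lbw
  generalize symLinU ρ B L μ y = lB
  generalize symLinU ρ W L μ y = lW
  generalize ((L : 𝕜) ^ d) = ℓ at hℓ ⊢
  generalize ((d ! : ℕ) : 𝕜) = D at hd ⊢
  match_scalars <;> (field_simp; try ring)

end OneParameter

end Summit.QuantumFields.BalabanUV.Beta.SymRootedJetDictionary
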